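import Summits.CriticalPhenomena.PercolationContinuityZ3.Theorems.SahiCMTP2CIS

/-!
# Stochastic monotonicity with a one-dimensional conditioning variable implies LTD (Fuchs–Wang Thm. 2.8 (3), density-free)

Support file of the Sahi cell (`prim-sahi`, typer seat, generation 18; `--supports stmt-CriticalPhenomena-4575`).
Theorems only (no definitions, no named facts, no sorries).

[FuchsWang2026] Thm. 2.8 (3) ("if `|A| = 1`, then `SI(X_B|X_A)` implies `LTD(X_B|X_A)`", attributed to [6]) completes
their Fig. 2.1.  Density-free, for a finite law on `X × Y` with `X` a CHAIN: stochastic monotonicity in the cylinder form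
`μ(C × Y) μ(D × (−∞,t]) ≤ μ(C × (−∞,t]) μ(D × Y)` for measurable pointwise-comparable `C ≤ D` (which (5.1) gives,
`cylinder_mul_le_of_isCMTP2Set`, and which on `Q_{d+1}` is the lower-set form of `CondIncrLastLE`, `cylinder_Iic_of_condIncrLastLE`) implies `IsLTD`
(**`isLTD_of_cylinder_chain`**: split `(−∞,y_A] = (−∞,x_A] ∪ (x_A,y_A]`, the two pieces being comparable BECAUSE `X` is a
chain — for `|A| ≥ 2` the implication fails, as the paper notes).  On `Q_2`: **`IsCISae.isLTD_two`** — for every CIS law (a.e.-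
kernel sense; `= CondIncrLastLE` by generation 17) the law of `(X₁, X₂)` on `[0,1]²` has `LTD(X₂|X₁)`.

No sorries, no new axioms.
-/

noncomputable section

namespace Summit.CriticalPhenomena.PercolationContinuityZ3.Theorems.SahiCMTP2

open MeasureTheory Set Function
open Literature.Probability.LatticeModels
open Summit.CriticalPhenomena.PercolationContinuityZ3.Theorems.SahiBoxTP2
open Summit.CriticalPhenomena.PercolationContinuityZ3.Theorems.SahiCIS
open scoped ENNReal SetFamily unitInterval

section Chain

variable {X Y : Type*} [MeasurableSpace X] [LinearOrder X] [TopologicalSpace X] [OrderClosedTopology X]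
  [OpensMeasurableSpace X] [MeasurableSpace Y] [Lattice Y] [TopologicalSpace Y] [ClosedIicTopology Y]
  [OpensMeasurableSpace Y]

/-- **Cylinder stochastic monotonicity with a chain as conditioning variable ⟹ LTD** (density-free [FuchsWang2026]
Thm. 2.8 (3)): split `(−∞,y_A] = (−∞,x_A] ∪ (x_A, y_A]` and compare the two comparable pieces. [this work] -/
theorem isLTD_of_cylinder_chain {μ : Measure (X × Y)}
    (h : ∀ ⦃C D : Set X⦄, MeasurableSet C → MeasurableSet D → (∀ c ∈ C, ∀ d ∈ D, c ≤ d) → ∀ t : Y,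
      μ (C ×ˢ univ) * μ (D ×ˢ Iic t) ≤ μ (C ×ˢ Iic t) * μ (D ×ˢ univ)) :
    IsLTD μ := by
  intro xA yA hle xB
  have hsplit : ∀ S : Set Y, (Iic yA : Set X) ×ˢ S = (Iic xA ×ˢ S) ∪ (Ioc xA yA ×ˢ S) := fun S => by
    rw [← Set.union_prod, Set.Iic_union_Ioc_eq_Iic hle]
  have hdisj : ∀ S : Set Y, Disjoint ((Iic xA : Set X) ×ˢ S) (Ioc xA yA ×ˢ S) := fun S =>
    Set.disjoint_prod.2 (Or.inl (Set.Iic_disjoint_Ioc le_rfl))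
  rw [hsplit (Iic xB), hsplit univ, measure_union (hdisj _) (measurableSet_Ioc.prod measurableSet_Iic),
    measure_union (hdisj _) (measurableSet_Ioc.prod MeasurableSet.univ), add_mul, mul_add]
  refine add_le_add le_rfl ?_
  rw [mul_comm]
  exact h measurableSet_Iic measurableSet_Ioc (fun c hc d hd => le_trans hc hd.1.le) xB

end Chain

/-! ### On `Q_2`: CIS ⟹ LTD -/

section Cube

/-- The lower-set cylinder form of the corrected Definition 4 (finite measures): for measurable pointwise-comparable
`A ≤ B` and every `t`, `μ(A × [0,1]) μ(B × [0,t]) ≤ μ(A × [0,t]) μ(B × [0,1])` (complement the printed upper-set form at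
`V = (t, 1]`). [this work] -/
theorem cylinder_Iic_of_condIncrLastLE {d : ℕ} {μ : Measure (Fin (d + 1) → I)} [IsFiniteMeasure μ]
    (h : CondIncrLastLE μ) {A B : Set (Fin d → I)} (hA : MeasurableSet A) (hB : MeasurableSet B)
    (hAB : ∀ a ∈ A, ∀ b ∈ B, a ≤ b) (t : I) :
    μ.map initLast (A ×ˢ univ) * μ.map initLast (B ×ˢ Iic t) ≤
      μ.map initLast (A ×ˢ Iic t) * μ.map initLast (B ×ˢ univ) := by
  set ν := μ.map initLast with hν
  haveI : IsFiniteMeasure ν := Measure.isFiniteMeasure_map μ _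
  have key := h hA hB hAB (isUpperSet_Ioi t) measurableSet_Ioi
  rw [fst_eq_add_prod_compl' ν hB (measurableSet_Iic (a := t)), fst_eq_add_prod_compl' ν hA (measurableSet_Iic (a := t)),
    Set.compl_Iic] at key
  -- key : ν(A × Ioi t) (ν(B × Iic t) + ν(B × Ioi t)) ≤ ν(B × Ioi t) (ν(A × Iic t) + ν(A × Ioi t))
  have hunivA : ν (A ×ˢ univ) = ν (A ×ˢ Iic t) + ν (A ×ˢ Ioi t) := by
    rw [← fst_apply_eq_prod_univ ν hA, fst_eq_add_prod_compl' ν hA (measurableSet_Iic (a := t)), Set.compl_Iic]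
  have hunivB : ν (B ×ˢ univ) = ν (B ×ˢ Iic t) + ν (B ×ˢ Ioi t) := by
    rw [← fst_apply_eq_prod_univ ν hB, fst_eq_add_prod_compl' ν hB (measurableSet_Iic (a := t)), Set.compl_Iic]
  rw [hunivA, hunivB, add_mul, mul_add]
  refine add_le_add le_rfl ?_
  -- from key: qA pB + qA qB ≤ qB pA + qB qA ⟹ qA pB ≤ pA qB
  rw [mul_add, mul_add] at key
  have hfin : ν (A ×ˢ Ioi t) * ν (B ×ˢ Ioi t) ≠ ∞ := ENNReal.mul_ne_top (measure_ne_top _ _) (measure_ne_top _ _)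
  have key' : ν (A ×ˢ Ioi t) * ν (B ×ˢ Iic t) + ν (A ×ˢ Ioi t) * ν (B ×ˢ Ioi t) ≤
      ν (B ×ˢ Ioi t) * ν (A ×ˢ Iic t) + ν (A ×ˢ Ioi t) * ν (B ×ˢ Ioi t) := by
    calc _ ≤ ν (B ×ˢ Ioi t) * ν (A ×ˢ Iic t) + ν (B ×ˢ Ioi t) * ν (A ×ˢ Ioi t) := key
      _ = _ := by rw [mul_comm (ν (B ×ˢ Ioi t)) (ν (A ×ˢ Ioi t))]
  have := (ENNReal.add_le_add_iff_right hfin).1 key'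
  calc ν (A ×ˢ Ioi t) * ν (B ×ˢ Iic t) ≤ ν (B ×ˢ Ioi t) * ν (A ×ˢ Iic t) := this
    _ = ν (A ×ˢ Iic t) * ν (B ×ˢ Ioi t) := mul_comm _ _

/-- The law of `(x₀, x₁)` on `[0,1] × [0,1]` is the image of the law of `((x₀), x₁)` under `(u,t) ↦ (u 0, t)`. [folklore] -/
theorem pair_eq_eval_comp_initLast :
    (fun x : Fin 2 → I => (x 0, x 1)) = Prod.map (fun u : Fin 1 → I => u 0) id ∘ initLast := by
  funext x
  rfl

/-- **CIS ⟹ LTD on `[0,1]²`** (density-free [FuchsWang2026] Thm. 2.8 (3), `|A| = 1`): for every probability law `μ` on `Q_2`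
that is CIS in the a.e.-kernel sense, the law of `(X₁, X₂)` on `[0,1] × [0,1]` satisfies `LTD(X₂|X₁)`. [this work] -/
theorem _root_.Summit.CriticalPhenomena.PercolationContinuityZ3.Theorems.SahiCIS.IsCISae.isLTD_two
    (μ : Measure (Fin 2 → I)) [IsProbabilityMeasure μ] (h : IsCISae 2 μ) :
    IsLTD (μ.map fun x : Fin 2 → I => (x 0, x 1)) := by
  have hC := (isCISae_two_iff_condIncrLastLE μ).1 h
  have hev : Measurable fun u : Fin 1 → I => u 0 := measurable_pi_apply 0
  have hm : Measurable (Prod.map (fun u : Fin 1 → I => u 0) (id : I → I)) := hev.prodMap measurable_id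
  rw [pair_eq_eval_comp_initLast, ← Measure.map_map hm measurable_initLast]
  refine isLTD_of_cylinder_chain fun C D hC' hD' hCD t => ?_
  rw [Measure.map_apply hm (hC'.prod MeasurableSet.univ), Measure.map_apply hm (hD'.prod measurableSet_Iic),
    Measure.map_apply hm (hC'.prod measurableSet_Iic), Measure.map_apply hm (hD'.prod MeasurableSet.univ),
    Set.preimage_prod_map_prod, Set.preimage_prod_map_prod, Set.preimage_prod_map_prod, Set.preimage_prod_map_prod,
    Set.preimage_id, Set.preimage_id]
  exact cylinder_Iic_of_condIncrLastLE hC (hev hC') (hev hD')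
    (fun a ha b hb j => by rw [Subsingleton.elim j 0]; exact hCD (a 0) ha (b 0) hb) t

end Cube

end Summit.CriticalPhenomena.PercolationContinuityZ3.Theorems.SahiCMTP2
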